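import Literature.Computability.AlgebraicComplexity.BILPS19MinrankVarieties
import Literature.AlgebraicGeometry.DeterminantalHypersurfaces.LinearPencilForms
import Literature.LinearAlgebra.Matrix.RankMinors
import HarnessLib

/-!
# BILPS Thm 23 discharged: the basic equations vanish on the minrank varieties

Proof file (theorem-only) for `BILPS2019_thm23` of `BILPS19MinrankVarieties.lean`
(Bläser–Ikenmeyer–Lysikov–Pandey–Schreyer, arXiv:1911.02534, Thm 23, p0025:L27: "If `T ∈ 𝓜_r`,
then there exists a nonzero rank 1 symmetric tensor `x^{⊗(r+1)}` on which `M_{T,r}` vanishes. In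
particular, it means that the rank of `M_{T,r}` is less than the dimension of the source space
`S^{r+1}U`, so the `s × s` minors of `M_{T,r}` vanish."). As typed, the conclusion is the linear
dependence of the columns of `M_{T,r}` (coefficient vectors `minorCoeffColumn r T d` of the
monomials `x^d`, `|d| = r+1`, in the `(r+1)`-minors of `Tx`). Printed proof, formalised: at the
minrank witness `x ≠ 0` every `(r+1)`-minor of `Tx` vanishes (`rk(Tx) ≤ r`; the tree's
`det_submatrix_eq_zero_of_rank_lt_card`), each minor of the matrix of linear forms is a form of
degree `r+1` (the tree's `isHomogeneous_det_sum_X_smul`), so evaluating gives the relation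
`∑_d x^d · column_d = 0`, nontrivial at `d = (r+1)·e_{a₀}` with `x_{a₀} ≠ 0`. Valid over every field.
Honest framing (val-lit): a discharge of a typed literature fact; nothing here bears on `VP ≠ VNP`.
-/

noncomputable section

namespace Literature.Computability.AlgebraicComplexity

open MvPolynomial Matrix
open Literature.AlgebraicGeometry.DeterminantalHypersurfaces (isHomogeneous_det_sum_X_smul)
open Literature.LinearAlgebra.Matrix (det_submatrix_eq_zero_of_rank_lt_card)

section Thm23

variable {F : Type*} [Field F] {k m n : ℕ}

/-- A minor of the matrix of linear forms `Tx` is the determinant of the linear pencil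
`∑_a X_a · (T_a)_{I,J}`. [cite: BlaserIkenmeyerLysikovPandeySchreyer2019, §7.1] -/
theorem det_contractPoly_submatrix_eq {r : ℕ} (T : Fin k → Fin m → Fin n → F)
    (I : Fin (r + 1) → Fin m) (J : Fin (r + 1) → Fin n) :
    ((contractPoly T).submatrix I J).det =
      (∑ a, (X a : MvPolynomial (Fin k) F) •
        (Matrix.of fun i j => T a (I i) (J j)).map C :
          Matrix (Fin (r + 1)) (Fin (r + 1)) (MvPolynomial (Fin k) F)).det := by
  congr 1
  ext i j
  simp [contractPoly, Matrix.sum_apply]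

/-- Each `(r+1)`-minor of `Tx` is a form of degree `r + 1` in `x`.
[cite: BlaserIkenmeyerLysikovPandeySchreyer2019, §7.1] -/
theorem isHomogeneous_det_contractPoly_submatrix {r : ℕ} (T : Fin k → Fin m → Fin n → F)
    (I : Fin (r + 1) → Fin m) (J : Fin (r + 1) → Fin n) :
    ((contractPoly T).submatrix I J).det.IsHomogeneous (r + 1) := by
  rw [det_contractPoly_submatrix_eq]
  simpa using isHomogeneous_det_sum_X_smul (fun a => (Matrix.of fun i j => T a (I i) (J j)))

/-- Evaluating a minor of `Tx` at `x` gives the corresponding minor of the contraction `Tx`.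
[cite: BlaserIkenmeyerLysikovPandeySchreyer2019, §7.1] -/
theorem eval_det_contractPoly_submatrix {r : ℕ} (T : Fin k → Fin m → Fin n → F)
    (I : Fin (r + 1) → Fin m) (J : Fin (r + 1) → Fin n) (x : Fin k → F) :
    eval x ((contractPoly T).submatrix I J).det = ((contract3 T x).submatrix I J).det := by
  rw [RingHom.map_det]
  congr 1
  ext i j
  simp [contractPoly, contract3_apply]

/-- At a point `x` with `rk(Tx) ≤ r` all `(r+1)`-minors of `Tx` vanish, i.e. the evaluation at `x`
of every minor polynomial is `0`. [cite: BlaserIkenmeyerLysikovPandeySchreyer2019, Thm. 23 (proof)] -/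
theorem eval_det_contractPoly_submatrix_eq_zero {r : ℕ} (T : Fin k → Fin m → Fin n → F)
    (I : Fin (r + 1) → Fin m) (J : Fin (r + 1) → Fin n) {x : Fin k → F}
    (hx : (contract3 T x).rank ≤ r) :
    eval x ((contractPoly T).submatrix I J).det = 0 := by
  rw [eval_det_contractPoly_submatrix]
  exact det_submatrix_eq_zero_of_rank_lt_card _ _ _ (by simp; omega)

end Thm23

/-- **BILPS Thm 23, discharged** (the relation `∑_{|d| = r+1} x^d · column_d(M_{T,r}) = 0` at a
minrank witness `x ≠ 0`, nontrivial at `d = (r+1) e_{a₀}`, `x_{a₀} ≠ 0`).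
[cite: BlaserIkenmeyerLysikovPandeySchreyer2019, Thm. 23] -/
theorem BILPS2019_thm23_holds : BILPS2019_thm23 := by
  intro F _ _ _ k m n r T hT hli
  classical
  obtain ⟨x, hx, hr⟩ := hT
  obtain ⟨a₀, ha₀⟩ : ∃ a, x a ≠ 0 := by
    by_contra h
    push Not at h
    exact hx (funext h)
  -- the finite set of columns entering the relation
  let P : (Fin k →₀ ℕ) → Prop := fun d => d.degree = r + 1
  let d₀ : {d : Fin k →₀ ℕ // d.degree = r + 1} :=
    ⟨Finsupp.single a₀ (r + 1), Finsupp.degree_single _ _⟩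
  let s : Finset {d : Fin k →₀ ℕ // d.degree = r + 1} :=
    insert d₀ ((Finset.univ.biUnion fun IJ : (Fin (r + 1) → Fin m) × (Fin (r + 1) → Fin n) =>
      ((contractPoly T).submatrix IJ.1 IJ.2).det.support).subtype P)
  let g : {d : Fin k →₀ ℕ // d.degree = r + 1} → F := fun d => ∏ a, x a ^ d.1 a
  -- the relation holds
  have hrel : ∑ d ∈ s, g d • minorCoeffColumn r T d.1 = 0 := by
    funext IJ
    rw [Finset.sum_apply, Pi.zero_apply]
    simp only [Pi.smul_apply, smul_eq_mul, minorCoeffColumn]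
    have hsupp : ((contractPoly T).submatrix IJ.1 IJ.2).det.support ⊆
        s.map (Function.Embedding.subtype P) := by
      intro d hd
      have hdeg : d.degree = r + 1 := by
        have hw := isHomogeneous_det_contractPoly_submatrix T IJ.1 IJ.2 (mem_support_iff.mp hd)
        rw [Finsupp.degree_eq_weight_one]
        exact hw
      rw [Finset.mem_map]
      refine ⟨⟨d, hdeg⟩, ?_, rfl⟩
      refine Finset.mem_insert_of_mem (Finset.mem_subtype.mpr ?_)
      exact Finset.mem_biUnion.mpr ⟨IJ, Finset.mem_univ _, hd⟩
    have h0 := eval_det_contractPoly_submatrix_eq_zero T IJ.1 IJ.2 hr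
    rw [eval_eq', Finset.sum_subset hsupp (fun d _ hd => by
      rw [notMem_support_iff.mp hd, zero_mul]), Finset.sum_map] at h0
    rw [← h0]
    refine Finset.sum_congr rfl fun d _ => ?_
    simp only [Function.Embedding.coe_subtype]
    ring
  -- but the coefficient at `d₀` is `x_{a₀}^{r+1} ≠ 0`
  have hzero := (linearIndependent_iff'.mp hli) s g hrel d₀ (Finset.mem_insert_self _ _)
  apply pow_ne_zero (r + 1) ha₀
  rw [← hzero]
  show x a₀ ^ (r + 1) = ∏ a, x a ^ (Finsupp.single a₀ (r + 1)) a
  rw [Finset.prod_eq_single a₀ (fun a _ ha => by rw [Finsupp.single_eq_of_ne ha, pow_zero])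
    (fun h => absurd (Finset.mem_univ a₀) h), Finsupp.single_eq_same]

end Literature.Computability.AlgebraicComplexity
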